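import Summits.ValiantsHypothesis.ValiantsHypothesis.Theorems.GrenetZeonDualUnipotentThreeHalvesHeavyTopThmC5KillS1
import Summits.ValiantsHypothesis.ValiantsHypothesis.Theorems.GrenetZeonDualUnipotentThreeHalvesHeavyTopThmC5KillS2
import Summits.ValiantsHypothesis.ValiantsHypothesis.Theorems.GrenetZeonDualUnipotentThreeHalvesHeavyTopThmC5KillS3
import Summits.ValiantsHypothesis.ValiantsHypothesis.Theorems.GrenetZeonDualUnipotentThreeHalvesHeavyTopThmC5WindowDot
import Summits.ValiantsHypothesis.ValiantsHypothesis.Theorems.GrenetZeonDualUnipotentThreeHalvesHeavyTopThmCnStructure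
import Summits.ValiantsHypothesis.ValiantsHypothesis.Theorems.GrenetZeonDualUnipotentThreeHalvesHeavyTopThmCStructure
import Summits.ValiantsHypothesis.ValiantsHypothesis.Theorems.GrenetZeonDualUnipotentThreeHalvesHeavyTopThmCRegularShift
import Summits.ValiantsHypothesis.ValiantsHypothesis.Theorems.GrenetZeonDualUnipotentThreeHalvesHeavyTopTorusInitial
import Summits.ValiantsHypothesis.ValiantsHypothesis.Theorems.GrenetZeonDualUnipotentThreeHalvesHeavyTopConjTransport
import Summits.ValiantsHypothesis.ValiantsHypothesis.Theorems.GrenetZeonDualUnipotentThreeHalvesHeavyTopIotaOfThmC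

/-!
# `GrenetZeon.DualUnipotentThreeHalves` (stmt-ValiantsHypothesis-24318), R2 heavy-top instrument — THEOREM C(5) IN THE KERNEL
# (`ι(5) ≤ C(5,2) − 2`; calibration instance of the Thm C(n) pipeline)

Experiment cell «val-heavytop-census» (D-0160), engine seat val-htc-eng-1 g4.  THEOREM C(5) (lead g0 `ROADMAP-codim1.md`, lead-g2 `THMC-CHECK.md`, machine for
`m ≤ 14`): a linear space `V ≤ M_5(ℂ)` of nilpotent matrices with `dim V = 9` containing a regular nilpotent (`Z^4 ≠ 0`) has a non-trivial proper
invariant subspace; with ✓ `HeavyTopIotaOfThmC.finrank_le_of_thmC` (Q1 theorem + index bound, kernel) every irreducible nilpotent `V ≤ M_5(ℂ)` has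
`dim V ≤ 8` (`ι(5) ≤ 8`, `def(5) ≥ 2` in the kernel).  Same pipeline as ✓ `…HeavyTopThmCSeven` (the case `n = 7`), size-general frame
✓ `…ThmCnGradedCount` / ✓ `…ThmCnStructure`, generated probes/certificates/dispatchers ✓ `…ThmC5ProbesS*` / `…ThmC5CertsS*` / `…ThmC5KillS*`.

PROOF (kernel port by COUNT + CERTIFICATES, replacing the pencil framework): conjugate the regular element to the shift `J` (✓ `…ThmCRegularShift`,
✓ `HeavyTopConjTransport`); graded limit `W` along `diag(t^6,…,t^0)` (✓ `HeavyTopTorusInitial`); trace-orthogonality count (✓ `…ThmCGradedCount`) ⇒ all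
heights but at most one `h*` are non-deficient; letters `J^h`, `E_{ij}` (`j − i > s`, `≠ h*`), `C̃_c` in `W` (✓ `…ThmCStructure`, ✓ `…ThmCWindow`, ✓ `…ThmCWindowDot`);
`s :=` lowest weight of `W`; `s = 0` ⇒ `ℂe₀` invariant; `s ≥ 2` ⇒ `N_s = 0` by the dispatchers ✓ `…ThmCKillS*` (probe traces ✓ `…ThmCProbesS*`,
Nullstellensatz certificates ✓ `…ThmCCertsS*`), contradiction; `s = 1` ⇒ `q₀q₂ = 0` on `N_1` ⇒ `span(e₀)` or `span(e₀,e₁,e₂)` invariant.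

* ★★ `thmC5_shift` — the theorem for `V ∋ J`;  ★★ `thmC5` — Theorem C(5);  ★ `iota_5_le` — `ι(5) ≤ 8`.

Honest framing: calibration datum of the census instrument (no GRID cell changes); nothing here proves or refutes `HeavyTopLaw`/`HeavyTopSlowLaw`,
24318, S3 or 8062; `VP ≠ VNP` is NOT proved.  No definitions.  [this seat]
-/

noncomputable section

-- single-conjunct layout: Sub = Summit, duplicated namespace component intended
set_option linter.dupNamespace false
set_option linter.unusedSimpArgs false
set_option linter.unnecessarySeqFocus false
set_option linter.unreachableTactic false
set_option linter.unusedTactic false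

namespace Summit.ValiantsHypothesis.ValiantsHypothesis.Theorems.GrenetZeon.HeavyTopThmC5

open Matrix
open Summit.ValiantsHypothesis.ValiantsHypothesis.Theorems.GrenetZeon.HeavyTopThmCTraceKit (forall_eq_zero_or_of_mul_eq_zero trace_mixed_eq_zero_of_mem)
open Summit.ValiantsHypothesis.ValiantsHypothesis.Theorems.GrenetZeon.HeavyTopThmCnGradedCount (dot_eq_zero dot_one_eq_zero finrank_add_le finrank_add_succ_le finrank_le_sum_range)
open Summit.ValiantsHypothesis.ValiantsHypothesis.Theorems.GrenetZeon.HeavyTopThmCnStructure (jpow_mem unit_mem lower_band_mem map_eq_top_of_finrank below_of_initial not_irreducible_of_column_strip)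
open Summit.ValiantsHypothesis.ValiantsHypothesis.Theorems.GrenetZeon.HeavyTopThmCStructure (mem_of_dot_eq_zero)
open Summit.ValiantsHypothesis.ValiantsHypothesis.Theorems.GrenetZeon.HeavyTopThmC5Window (window_2 window_3)
open Summit.ValiantsHypothesis.ValiantsHypothesis.Theorems.GrenetZeon.HeavyTopThmC5WindowDot (polyDot_2 polyDot_3)
open Summit.ValiantsHypothesis.ValiantsHypothesis.Theorems.GrenetZeon.HeavyTopThmCRegularShift (exists_isUnit_conj_eq_fullShift)
open Summit.ValiantsHypothesis.ValiantsHypothesis.Theorems.GrenetZeon.HeavyTopTorusInitial (exists_torus_initial_subspace_of_isNilpotent pow_eq_zero_of_isNilpotent)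
open Summit.ValiantsHypothesis.ValiantsHypothesis.Theorems.GrenetZeon.HeavyTopConjTransport (exists_conj_subspace not_irreducible_of_conj)
open Summit.ValiantsHypothesis.ValiantsHypothesis.Theorems.GrenetZeon.HeavyTopIotaOfThmC (finrank_le_of_thmC)


/-! ## Theorem C(5) with the shift inside -/

/-- ★★ **Theorem C(5), normalised form.**  A `9`-dimensional linear space of nilpotent `5 × 5` matrices containing the shift `J` has a non-trivial
proper invariant subspace. [lead g0 ROADMAP-codim1 Thm C; this seat (kernel port by count + certificates)] -/
theorem thmC5_shift (V : Submodule ℂ (Matrix (Fin 5) (Fin 5) ℂ)) (hV : ∀ A ∈ V, IsNilpotent A) (hdim : Module.finrank ℂ V = 9)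
    (hJV : (Matrix.of fun a b : Fin 5 => if (b : ℕ) = (a : ℕ) + 1 then (1 : ℂ) else 0) ∈ V) :
    ¬ ∀ U : Submodule ℂ (Fin 5 → ℂ), (∀ A ∈ V, ∀ x ∈ U, A *ᵥ x ∈ U) → U = ⊥ ∨ U = ⊤ := by
  classical
  -- the graded limit along `diag(t^6, …, t^0)`
  obtain ⟨W, hWdim, hWgr', hWinit', -, hWnil, -⟩ := exists_torus_initial_subspace_of_isNilpotent (fun a : Fin 5 => 4 - (a : ℕ)) V hV
  have projEq : ∀ (A : Matrix (Fin 5) (Fin 5) ℂ) (d : ℤ),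
      (Matrix.of fun a b : Fin 5 => if (b : ℤ) - (a : ℤ) = d then A a b else 0) =
      (Matrix.of fun a b : Fin 5 => if (((fun a : Fin 5 => 4 - (a : ℕ)) a : ℕ) : ℤ) - (((fun a : Fin 5 => 4 - (a : ℕ)) b : ℕ) : ℤ) = d
        then A a b else 0) := by
    intro A d; ext a b; simp only [Matrix.of_apply]
    split_ifs with h1 h2 h2 <;> first | rfl | (exfalso; omega)
  have hgr : ∀ A ∈ W, ∀ d : ℤ, (Matrix.of fun a b : Fin 5 => if (b : ℤ) - (a : ℤ) = d then A a b else 0) ∈ W := by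
    intro A hA d; rw [projEq]; exact hWgr' A hA d
  have hinit : ∀ Z ∈ V, ∀ d : ℤ, (∀ a b : Fin 5, (b : ℤ) - (a : ℤ) < d → Z a b = 0) →
      (Matrix.of fun a b : Fin 5 => if (b : ℤ) - (a : ℤ) = d then Z a b else 0) ∈ W := by
    intro Z hZ d hlow; rw [projEq]
    exact hWinit' Z hZ d (fun a b hab => hlow a b (by omega))
  -- `J ∈ W`
  have hJW : (Matrix.of fun a b : Fin 5 => if (b : ℕ) = (a : ℕ) + 1 then (1 : ℂ) else 0) ∈ W := by
    have h1 := hinit _ hJV 1 (fun a b hab => by rw [Matrix.of_apply, if_neg]; omega)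
    have e : (Matrix.of fun a b : Fin 5 => if (b : ℤ) - (a : ℤ) = (1 : ℤ) then (Matrix.of fun a b : Fin 5 => if (b : ℕ) = (a : ℕ) + 1 then (1 : ℂ) else 0) a b else 0) =
        (Matrix.of fun a b : Fin 5 => if (b : ℕ) = (a : ℕ) + 1 then (1 : ℂ) else 0) := by
      ext a b; simp only [Matrix.of_apply]
      by_cases hb : (b : ℕ) = (a : ℕ) + 1
      · rw [if_pos (by omega), if_pos hb]
      · rw [if_neg hb]; split_ifs <;> rfl
    rw [e] at h1; exact h1
  -- the diagonal-extraction maps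
  let dp : ∀ h : ℕ, Matrix (Fin 5) (Fin 5) ℂ →ₗ[ℂ] (Fin (5 - h) → ℂ) := fun h =>
    LinearMap.pi fun i : Fin (5 - h) => Matrix.entryLinearMap ℂ ℂ (⟨(i : ℕ), by omega⟩ : Fin 5) (⟨(i : ℕ) + h, by omega⟩ : Fin 5)
  let dm : ∀ h : ℕ, Matrix (Fin 5) (Fin 5) ℂ →ₗ[ℂ] (Fin (5 - h) → ℂ) := fun h =>
    LinearMap.pi fun i : Fin (5 - h) => Matrix.entryLinearMap ℂ ℂ (⟨(i : ℕ) + h, by omega⟩ : Fin 5) (⟨(i : ℕ), by omega⟩ : Fin 5)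
  have hdp : ∀ h A (i : Fin (5 - h)) (a b : Fin 5), (a : ℕ) = i → (b : ℕ) = i + h → dp h A i = A a b := by
    intro h A i a b ha hb
    obtain ⟨a, ha'⟩ := a
    obtain ⟨b, hb'⟩ := b
    simp only at ha hb
    subst ha; subst hb; rfl
  have hdm : ∀ h A (i : Fin (5 - h)) (a b : Fin 5), (a : ℕ) = i + h → (b : ℕ) = i → dm h A i = A a b := by
    intro h A i a b ha hb
    obtain ⟨a, ha'⟩ := a
    obtain ⟨b, hb'⟩ := b
    simp only at ha hb
    subst ha; subst hb; rfl
  -- orthogonality, sums, bounds, count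
  have hPN : ∀ h, ∀ q ∈ W.map (dm h), ∀ p ∈ W.map (dp h), q ⬝ᵥ p = 0 :=
    fun h => dot_eq_zero W hWnil hgr h (dp h) (dm h) (hdp h) (hdm h)
  have hN1 : ∀ h, ∀ q ∈ W.map (dm h), q ⬝ᵥ (fun _ => (1 : ℂ)) = 0 :=
    fun h => dot_one_eq_zero W hWnil hgr hJW h (dm h) (hdm h)
  have hb : ∀ h, Module.finrank ℂ (W.map (dp h)) + Module.finrank ℂ (W.map (dm h)) ≤ 5 - h :=
    fun h => finrank_add_le h _ _ (hPN h)
  have hb' : ∀ h, (fun _ => (1 : ℂ)) ∉ W.map (dp h) →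
      Module.finrank ℂ (W.map (dp h)) + Module.finrank ℂ (W.map (dm h)) + 1 ≤ 5 - h :=
    fun h hone => finrank_add_succ_le h _ _ (hPN h) (hN1 h) hone
  have hcount := finrank_le_sum_range W hWnil hgr dp dm hdp hdm
  rw [hWdim, hdim] at hcount
  have hcount' : 9 ≤ Module.finrank ℂ (W.map (dp 1)) + Module.finrank ℂ (W.map (dm 1)) +
      (Module.finrank ℂ (W.map (dp 2)) + Module.finrank ℂ (W.map (dm 2))) +
      (Module.finrank ℂ (W.map (dp 3)) + Module.finrank ℂ (W.map (dm 3))) +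
      (Module.finrank ℂ (W.map (dp 4)) + Module.finrank ℂ (W.map (dm 4))) := by
    have h := hcount
    simp only [Finset.sum_range_succ, Finset.sum_range_zero, zero_add] at h
    exact h
  -- the deficient height
  have key : ∃ hstar : ℕ, ∀ h : ℕ, 1 ≤ h → h ≤ 4 → h ≠ hstar →
      (Module.finrank ℂ (W.map (dp h)) + Module.finrank ℂ (W.map (dm h)) = 5 - h ∧ (fun _ => (1 : ℂ)) ∈ W.map (dp h)) := by
    by_contra hcon
    push Not at hcon
    have slack : ∀ h, (Module.finrank ℂ (W.map (dp h)) + Module.finrank ℂ (W.map (dm h)) = 5 - h → (fun _ => (1 : ℂ)) ∉ W.map (dp h)) →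
        Module.finrank ℂ (W.map (dp h)) + Module.finrank ℂ (W.map (dm h)) + 1 ≤ 5 - h := by
      intro h himp
      by_cases heq : Module.finrank ℂ (W.map (dp h)) + Module.finrank ℂ (W.map (dm h)) = 5 - h
      · exact hb' h (himp heq)
      · have := hb h; omega
    obtain ⟨h₁, h11, h16, -, hbad1⟩ := hcon 0
    obtain ⟨h₂, h21, h26, hne, hbad2⟩ := hcon h₁
    have s1 := slack h₁ hbad1
    have s2 := slack h₂ hbad2
    have b1 := hb 1; have b2 := hb 2; have b3 := hb 3; have b4 := hb 4
    interval_cases h₁ <;> interval_cases h₂ <;> omega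
  obtain ⟨hstar, key⟩ := key
  -- the lowest weight
  obtain ⟨s, hs⟩ : ∃ s, Nat.findGreatest (fun h => W.map (dm h) ≠ ⊥) 4 = s := ⟨_, rfl⟩
  obtain ⟨hs6, hsP, hsmax⟩ := Nat.findGreatest_eq_iff.1 hs
  have hNabove : ∀ h, s < h → h < 5 → W.map (dm h) = ⊥ := fun h h1 h2 => not_not.1 (hsmax h1 (by omega))
  have hbelow := below_of_initial V W hinit dm hdm s hNabove
  -- letters available below the deficient height
  have hJpow : ∀ h : ℕ, 2 ≤ h → h ≤ 4 → h ≠ hstar →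
      (Matrix.of fun a b : Fin 5 => if (b : ℕ) = (a : ℕ) + h then (1 : ℂ) else 0) ∈ W :=
    fun h h2 h6 hne => jpow_mem W hgr h (dp h) (hdp h) (key h (by omega) h6 hne).2
  have hUnit : ∀ i j : ℕ, j ≤ 4 → i + s < j → j ≠ i + hstar →
      (Matrix.of fun a b : Fin 5 => if (a : ℕ) = i ∧ (b : ℕ) = j then (1 : ℂ) else 0) ∈ W := by
    intro i j hj hij hne
    obtain ⟨gsum, -⟩ := key (j - i) (by omega) (by omega) (by omega)
    have hNbot : W.map (dm (j - i)) = ⊥ := hNabove (j - i) (by omega) (by omega)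
    rw [hNbot, finrank_bot, add_zero] at gsum
    have hPtop : W.map (dp (j - i)) = ⊤ := map_eq_top_of_finrank (j - i) _ gsum
    have hmem : Pi.single (⟨i, by omega⟩ : Fin (5 - (j - i))) (1 : ℂ) ∈ W.map (dp (j - i)) := by
      rw [hPtop]; exact Submodule.mem_top
    have h1 := unit_mem W hgr (j - i) (dp (j - i)) (hdp (j - i)) ⟨i, by omega⟩ hmem
    have e : (Matrix.of fun a b : Fin 5 => if (a : ℕ) = i ∧ (b : ℕ) = j then (1 : ℂ) else 0) =
        (Matrix.of fun a b : Fin 5 => if (a : ℕ) = ((⟨i, by omega⟩ : Fin (5 - (j - i))) : ℕ) ∧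
          (b : ℕ) = ((⟨i, by omega⟩ : Fin (5 - (j - i))) : ℕ) + (j - i) then (1 : ℂ) else 0) := by
      ext a b; simp only [Matrix.of_apply, Fin.val_mk]
      have hij' : i + (j - i) = j := by omega
      rw [hij']
    rw [e]; exact h1
  -- case split on the lowest weight
  rcases Nat.eq_zero_or_pos s with hs0 | hspos
  · -- `s = 0`: every member of `V` is upper triangular
    subst hs0
    exact not_irreducible_of_column_strip V 0 (by norm_num) (fun X hX a b hb0 ha => hbelow X hX a b (by omega))
  obtain ⟨x, hxN, hx0⟩ := (Submodule.ne_bot_iff _).1 (hsP (by omega))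
  obtain ⟨B, hB, rfl⟩ := hxN
  have hs5 : s ≤ 3 := by
    by_contra hs5
    have hs6' : s = 4 := by omega
    subst hs6'
    apply hx0
    funext i
    have h1 := hN1 4 _ ⟨B, hB, rfl⟩
    rw [dotProduct, Finset.sum_eq_single i (fun j _ hj => absurd (Fin.ext (by omega) : j = i) hj)
      (fun h => absurd (Finset.mem_univ i) h), mul_one] at h1
    exact h1

  interval_cases s
  · -- lowest weight s = 1: `q₀ q₂ = 0` on `N_1`, then an invariant flag piece
    have hprod : ∀ x ∈ W.map (dm 1),
        (LinearMap.proj (⟨0, by omega⟩ : Fin (5 - 1)) : (Fin (5 - 1) → ℂ) →ₗ[ℂ] ℂ) x *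
          (LinearMap.proj (⟨2, by omega⟩ : Fin (5 - 1)) : (Fin (5 - 1) → ℂ) →ₗ[ℂ] ℂ) x = 0 := by
      rintro _ ⟨B, hB, rfl⟩
      simp only [LinearMap.coe_proj, Function.eval]
      obtain ⟨c, hc⟩ : ∃ c : Fin 5 → ℂ, ∀ b : Fin 5, c b = if hb : (b : ℕ) < 5 - 1 then dm 1 B ⟨(b : ℕ), hb⟩ else 0 := ⟨_, fun _ => rfl⟩
      have hc' : ∀ i : Fin (5 - 1), c ⟨(i : ℕ), by omega⟩ = dm 1 B i := fun i => by rw [hc, dif_pos i.isLt]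
      have hYc : (Matrix.of fun a b : Fin 5 => if (a : ℕ) = (b : ℕ) + 1 then c b else 0) ∈ W := lower_band_mem W hgr 1 (dm 1) (hdm 1) B hB c hc'
      have hC : hstar ≠ 1 → (Matrix.of fun a b : Fin 5 => if (a : ℕ) = (b : ℕ) + 1 then (![c 0, c 1, c 2, c 3, 0] : Fin 5 → ℂ) b else 0) ∈ W := by
        intro _
        have e : (Matrix.of fun a b : Fin 5 => if (a : ℕ) = (b : ℕ) + 1 then (![c 0, c 1, c 2, c 3, 0] : Fin 5 → ℂ) b else 0) =
            (Matrix.of fun a b : Fin 5 => if (a : ℕ) = (b : ℕ) + 1 then c b else 0) := by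
          ext a b
          simp only [Matrix.of_apply]
          by_cases hab : (a : ℕ) = (b : ℕ) + 1
          · rw [if_pos hab, if_pos hab]
            have hb6 : (b : ℕ) < 4 := by omega
            fin_cases b <;> first | rfl | exact absurd hb6 (by decide)
          · rw [if_neg hab, if_neg hab]
        rw [e]; exact hYc
      rcases Summit.ValiantsHypothesis.ValiantsHypothesis.Theorems.GrenetZeon.HeavyTopThmC5KillS1.kill hstar W hWnil c hYc hJW hJpow hUnit hC with hz | ⟨-, h02⟩
      · have h0 := hz 0 (by norm_num)
        rw [hc, dif_pos (by norm_num)] at h0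
        exact mul_eq_zero_of_left h0 _
      · have e0 : c 0 = dm 1 B ⟨0, by omega⟩ := by rw [hc, dif_pos (by norm_num)]; rfl
        have e2 : c 2 = dm 1 B ⟨2, by omega⟩ := by rw [hc, dif_pos (by norm_num)]; rfl
        rw [e0, e2] at h02
        exact h02
    -- entries `X_{m+1,m}` of members of `V` are coordinates of weight-`(−1)` vectors of `W`
    have hentry : ∀ X ∈ V, ∀ (m : Fin (5 - 1)) (a b : Fin 5), (a : ℕ) = m + 1 → (b : ℕ) = m →
        X a b = dm 1 (Matrix.of fun a b : Fin 5 => if (b : ℤ) - (a : ℤ) = (-1 : ℤ) then X a b else 0) m := by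
      intro X hX m a b ha hb'
      rw [hdm 1 _ m a b ha hb', Matrix.of_apply, if_pos (by omega)]
    have hXW : ∀ X ∈ V, (Matrix.of fun a b : Fin 5 => if (b : ℤ) - (a : ℤ) = (-1 : ℤ) then X a b else 0) ∈ W :=
      fun X hX => hinit X hX (-1) (fun a b hab => hbelow X hX a b (by omega))
    rcases forall_eq_zero_or_of_mul_eq_zero (W.map (dm 1)) _ _ hprod with h0 | h2
    · refine not_irreducible_of_column_strip V 0 (by norm_num) (fun X hX a b hb0 ha => ?_)
      by_cases hlt : (b : ℕ) + 1 < (a : ℕ)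
      · exact hbelow X hX a b hlt
      · rw [hentry X hX ⟨0, by omega⟩ a b (show (a : ℕ) = 0 + 1 by omega) (show (b : ℕ) = 0 by omega)]
        have := h0 _ ⟨_, hXW X hX, rfl⟩
        simpa only [LinearMap.coe_proj, Function.eval] using this
    · refine not_irreducible_of_column_strip V 2 (by norm_num) (fun X hX a b hb2 ha => ?_)
      by_cases hlt : (b : ℕ) + 1 < (a : ℕ)
      · exact hbelow X hX a b hlt
      · rw [hentry X hX ⟨2, by omega⟩ a b (show (a : ℕ) = 2 + 1 by omega) (show (b : ℕ) = 2 by omega)]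
        have := h2 _ ⟨_, hXW X hX, rfl⟩
        simpa only [LinearMap.coe_proj, Function.eval] using this
  · -- lowest weight s = 2
    obtain ⟨c, hc⟩ : ∃ c : Fin 5 → ℂ, ∀ b : Fin 5, c b = if hb : (b : ℕ) < 5 - 2 then dm 2 B ⟨(b : ℕ), hb⟩ else 0 := ⟨_, fun _ => rfl⟩
    have hc' : ∀ i : Fin (5 - 2), c ⟨(i : ℕ), by omega⟩ = dm 2 B i := fun i => by rw [hc, dif_pos i.isLt]
    have hYc : (Matrix.of fun a b : Fin 5 => if (a : ℕ) = (b : ℕ) + 2 then c b else 0) ∈ W := lower_band_mem W hgr 2 (dm 2) (hdm 2) B hB c hc'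
    have hC : hstar ≠ 1 → (Matrix.of fun a b : Fin 5 => if (a : ℕ) = (b : ℕ) + 1 then (![c 0, c 0 + c 1, c 1 + c 2, c 2, 0] : Fin 5 → ℂ) b else 0) ∈ W := by
      intro hne1
      obtain ⟨gsum, -⟩ := key 1 (by norm_num) (by norm_num) (Ne.symm hne1)
      have hortho : ∀ v ∈ W.map (dp 1), (fun k : Fin (5 - 1) => (![c 0, c 0 + c 1, c 1 + c 2, c 2, 0] : Fin 5 → ℂ) ⟨(k : ℕ), by omega⟩) ⬝ᵥ v = 0 := by
        rintro _ ⟨A, hA, rfl⟩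
        obtain ⟨p, hp⟩ : ∃ p : Fin 5 → ℂ, ∀ a : Fin 5, p a = if ha : (a : ℕ) < 5 - 1 then dp 1 A ⟨(a : ℕ), ha⟩ else 0 := ⟨_, fun _ => rfl⟩
        have hmix := trace_mixed_eq_zero_of_mem W hWnil hJW (hgr A hA 1) hYc 2
        have hZeq : (Matrix.of fun a b : Fin 5 => if (b : ℤ) - (a : ℤ) = (1 : ℤ) then A a b else 0) =
            (Matrix.of fun a b : Fin 5 => if (b : ℕ) = (a : ℕ) + 1 then p a else 0) := by
          ext a b
          simp only [Matrix.of_apply]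
          by_cases hb : (b : ℕ) = (a : ℕ) + 1
          · rw [if_pos (by omega), if_pos hb, hp, dif_pos (by omega),
              hdp 1 A ⟨(a : ℕ), by omega⟩ a b rfl (show (b : ℕ) = (a : ℕ) + 1 by omega)]
          · rw [if_neg (by omega), if_neg hb]
        rw [hZeq, window_2 c p, polyDot_2 c (dp 1 A) p hp] at hmix
        exact hmix
      obtain ⟨B', hB', hB'e⟩ := mem_of_dot_eq_zero (W.map (dp 1)) (W.map (dm 1)) (hPN 1) gsum _ hortho
      exact lower_band_mem W hgr 1 (dm 1) (hdm 1) B' hB' (![c 0, c 0 + c 1, c 1 + c 2, c 2, 0] : Fin 5 → ℂ) (fun i => by rw [hB'e])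
    have hz := Summit.ValiantsHypothesis.ValiantsHypothesis.Theorems.GrenetZeon.HeavyTopThmC5KillS2.kill hstar W hWnil c hYc hJW hJpow hUnit hC
    exfalso
    apply hx0
    funext i
    have hi := hz ⟨(i : ℕ), by omega⟩ (show (i : ℕ) + 2 ≤ 4 by omega)
    rw [hc' i] at hi
    exact hi
  · -- lowest weight s = 3
    obtain ⟨c, hc⟩ : ∃ c : Fin 5 → ℂ, ∀ b : Fin 5, c b = if hb : (b : ℕ) < 5 - 3 then dm 3 B ⟨(b : ℕ), hb⟩ else 0 := ⟨_, fun _ => rfl⟩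
    have hc' : ∀ i : Fin (5 - 3), c ⟨(i : ℕ), by omega⟩ = dm 3 B i := fun i => by rw [hc, dif_pos i.isLt]
    have hYc : (Matrix.of fun a b : Fin 5 => if (a : ℕ) = (b : ℕ) + 3 then c b else 0) ∈ W := lower_band_mem W hgr 3 (dm 3) (hdm 3) B hB c hc'
    have hC : hstar ≠ 1 → (Matrix.of fun a b : Fin 5 => if (a : ℕ) = (b : ℕ) + 1 then (![c 0, c 0 + c 1, c 0 + c 1, c 1, 0] : Fin 5 → ℂ) b else 0) ∈ W := by
      intro hne1
      obtain ⟨gsum, -⟩ := key 1 (by norm_num) (by norm_num) (Ne.symm hne1)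
      have hortho : ∀ v ∈ W.map (dp 1), (fun k : Fin (5 - 1) => (![c 0, c 0 + c 1, c 0 + c 1, c 1, 0] : Fin 5 → ℂ) ⟨(k : ℕ), by omega⟩) ⬝ᵥ v = 0 := by
        rintro _ ⟨A, hA, rfl⟩
        obtain ⟨p, hp⟩ : ∃ p : Fin 5 → ℂ, ∀ a : Fin 5, p a = if ha : (a : ℕ) < 5 - 1 then dp 1 A ⟨(a : ℕ), ha⟩ else 0 := ⟨_, fun _ => rfl⟩
        have hmix := trace_mixed_eq_zero_of_mem W hWnil hJW (hgr A hA 1) hYc 3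
        have hZeq : (Matrix.of fun a b : Fin 5 => if (b : ℤ) - (a : ℤ) = (1 : ℤ) then A a b else 0) =
            (Matrix.of fun a b : Fin 5 => if (b : ℕ) = (a : ℕ) + 1 then p a else 0) := by
          ext a b
          simp only [Matrix.of_apply]
          by_cases hb : (b : ℕ) = (a : ℕ) + 1
          · rw [if_pos (by omega), if_pos hb, hp, dif_pos (by omega),
              hdp 1 A ⟨(a : ℕ), by omega⟩ a b rfl (show (b : ℕ) = (a : ℕ) + 1 by omega)]
          · rw [if_neg (by omega), if_neg hb]
        rw [hZeq, window_3 c p, polyDot_3 c (dp 1 A) p hp] at hmix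
        exact hmix
      obtain ⟨B', hB', hB'e⟩ := mem_of_dot_eq_zero (W.map (dp 1)) (W.map (dm 1)) (hPN 1) gsum _ hortho
      exact lower_band_mem W hgr 1 (dm 1) (hdm 1) B' hB' (![c 0, c 0 + c 1, c 0 + c 1, c 1, 0] : Fin 5 → ℂ) (fun i => by rw [hB'e])
    have hz := Summit.ValiantsHypothesis.ValiantsHypothesis.Theorems.GrenetZeon.HeavyTopThmC5KillS3.kill hstar W hWnil c hYc hJW hJpow hUnit hC
    exfalso
    apply hx0
    funext i
    have hi := hz ⟨(i : ℕ), by omega⟩ (show (i : ℕ) + 3 ≤ 4 by omega)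
    rw [hc' i] at hi
    exact hi

/-- ★★ **THEOREM C(5).**  Every `9`-dimensional linear space of nilpotent `5 × 5` complex matrices containing a regular nilpotent (`Z^4 ≠ 0`)
has a non-trivial proper invariant subspace. [lead g0 ROADMAP-codim1 Thm C (pencil) + lead-g2 THMC-CHECK (machine); this seat: kernel] -/
theorem thmC5 : ∀ V : Submodule ℂ (Matrix (Fin 5) (Fin 5) ℂ), (∀ A ∈ V, IsNilpotent A) → Module.finrank ℂ V = 9 →
    (∃ Z ∈ V, Z ^ 4 ≠ 0) → ¬ ∀ U : Submodule ℂ (Fin 5 → ℂ), (∀ A ∈ V, ∀ x ∈ U, A *ᵥ x ∈ U) → U = ⊥ ∨ U = ⊤ := by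
  intro V hV hdim hZ
  obtain ⟨Z, hZV, hZ6⟩ := hZ
  have hZ7 : Z ^ 5 = 0 := pow_eq_zero_of_isNilpotent Z (hV Z hZV)
  obtain ⟨P, hP, hPZ⟩ := exists_isUnit_conj_eq_fullShift (m := 4) Z hZ7 hZ6
  obtain ⟨V', hV'dim, hVV', -, -, hV'pow⟩ := exists_conj_subspace P hP V
  have hV'nil : ∀ A ∈ V', IsNilpotent A := fun A hA =>
    ⟨5, hV'pow 5 (fun Z hZ => pow_eq_zero_of_isNilpotent Z (hV Z hZ)) A hA⟩
  have hJ : (Matrix.of fun a b : Fin 5 => if (b : ℕ) = (a : ℕ) + 1 then (1 : ℂ) else 0) ∈ V' := by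
    rw [← hPZ]; exact hVV' Z hZV
  exact not_irreducible_of_conj P hP V V' hVV' (thmC5_shift V' hV'nil (hV'dim.trans hdim) hJ)

/-- ★ **`ι(5) ≤ 8` in the kernel**: every irreducible linear space of nilpotent `5 × 5` complex matrices has dimension `≤ 8`
(✓ `HeavyTopIotaOfThmC.finrank_le_of_thmC` ∘ `thmC5`). -/
theorem iota_5_le (V : Submodule ℂ (Matrix (Fin 5) (Fin 5) ℂ)) (hV : ∀ A ∈ V, IsNilpotent A)
    (hirr : ∀ U : Submodule ℂ (Fin 5 → ℂ), (∀ A ∈ V, ∀ x ∈ U, A *ᵥ x ∈ U) → U = ⊥ ∨ U = ⊤) : Module.finrank ℂ V ≤ 8 := by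
  have h := finrank_le_of_thmC (s := 4) (by norm_num)
    (fun V' hV' hdim' hZ' => thmC5 V' hV' (by rw [hdim']; decide) hZ') V hV hirr
  have e : (4 + 1).choose 2 - 2 = 8 := by decide
  rw [e] at h
  exact h

end Summit.ValiantsHypothesis.ValiantsHypothesis.Theorems.GrenetZeon.HeavyTopThmC5

end
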